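import Literature.Barriers.QuantumAdvantage.RandomOracleMethodProofs
import Literature.Computability.QuantumComplexity.AaronsonAmbainisThm23
import Literature.Computability.QuantumComplexity.AaronsonAmbainisThm23Reduction
import Literature.Computability.QuantumComplexity.OracleCircuitLocality
import Mathlib.MeasureTheory.OuterMeasure.BorelCantelli
import Mathlib.MeasureTheory.Integral.Lebesgue.Markov
import Mathlib.Analysis.PSeries
import Mathlib.Analysis.SpecificLimits.Basic
import HarnessLib

/-!
# Aaronson–Ambainis 2014, Thm. 7 (iii) (= Thm. 23) from claim (apx): the probabilistic half, proved

Sibling proof file of `RandomOracleMethod.lean` (D-0014: the fact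
`Literature.Barriers.QuantumAdvantage.aaronsonAmbainis2014_thm7iii` stays a `def`). The proof of
Aaronson–Ambainis' Thm. 23 (arXiv:0911.0996v3, p. 14) consists of the efficient-simulation claim
(apx) — "there exists a deterministic polynomial-time algorithm `C` such that for all `Q` and
`x ∈ {0,1}ⁿ`, `Pr_A[|p̃_x(A) − p_x(A)| > 1/10] < 1/n³`", an internal claim of that proof and
therefore NOT a named fact (D-0026): it enters this file as the explicit hypothesis of
`aaronsonAmbainis2014_thm7iii_of_apx`, in the thresholded per-machine form which
`QuantumComplexity/AaronsonAmbainisThm23Reduction.lean` derives from the polynomial-time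
implementability of the simulation trees — and a probabilistic argument, which this file
carries out over the tree's models (`randomOracleMeasure`, `BQPRel`, `AvgPRel`, `errFraction`):

* `badEvent F C q x` — the `BQP` promise holds for `F^A` at `x` but `C^A(x)` errs (the event of
  (apx)); measurable (`measurableSet_badEvent`: oracle locality of circuits,
  `OracleCircuitLocality.lean`, and of transcript machines, `AlmostPProofs.isDetermined_runEvent`);
  `badCount F C q n A` — the number of bad inputs of length `n` ("`δ_n(A) · 2ⁿ`");
* **Markov** (`measure_manyBad_le`): `μ {A | δ_n(A) ≥ 1/n} ≤ 1/n²` from `μ (badEvent x) < 1/n³`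
  ("by (apx) together with Markov's inequality, `Pr_A[δ_n(A) > 1/n] < 1/n²`"; Mathlib's
  `mul_meas_ge_le_lintegral` on the sum of the indicators);
* **Borel–Cantelli** (`ae_eventually_few_bad`): "Since `Σ 1/n²` converges, `δ_n(A) ≤ 1/n` for all
  but finitely many values of `n`, with probability `1` over `A`" (Mathlib's
  `ae_eventually_notMem`, `Real.summable_one_div_nat_pow`);
* `errFraction_le_badCount`: under the `BQP^A` promise for `L` via `F`, the error fraction of
  `C^A` about `L` at length `n` is at most `δ_n(A)`;
* **`ae_BQPRel_subset_AvgPRel_of_apxMachines`** (unconditional): "Since the number of `BQP^A`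
  languages is countable" — here: the uniform families are countable (`countable_setOf_isUniform`),
  `ae_all_iff` — if every uniform `F` has an (apx)-machine `C_F`, then almost every `A` has, for
  every uniform `F`, eventually `δ_n(A) ≤ 1/n`; then every `L ∈ BQP^A` (witness `F`) is in
  `AvgP^A` with the machine `C_F`: its error fraction tends to `0` (squeeze). No
  finitely-many-lengths hard-wiring is needed since `AvgPRel` asks for `errFraction → 0` only.
* **`aaronsonAmbainis2014_thm7iii_of_apx`**: Thm. 7 (iii) from claim (apx) (hypothesis spelled
  out); `randomOracleMethod_of_apx`: with `fortnowRogers1999_thm44_holds`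
  (`RandomOracleMethodProofs.lean`) the barrier `RandomOracleMethod` holds granted (apx) alone.
* **`aaronsonAmbainis2014_thm7iii_of_dyadicMachines`**, `randomOracleMethod_of_dyadicMachines` —
  THE REMAINING OBLIGATION for discharging `aaronsonAmbainis2014_thm7iii` (and the barrier), as
  one explicit hypothesis: for the constants `c, 2^{-k}` of Conjecture 6 and under `P = P^{#P}`,
  every uniform Clifford+T oracle family `F` has a polynomial-time transcript machine computing
  `A, x ↦ [ (simTreeOn c 2^{-k} F x).eval (oracleBits F x A) ≥ 1/2 ]` ("we can implement `C`
  using … `poly(n)` computation steps": `α_M`, `E[p_j]` in `P^{#P}`, `Vr`/`Inf_i` in the second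
  level of `CH`, the least influential `i` in the third, `CH = P` under `P = P^{#P}` —
  `CH_eq_P_of_P_eq_PSharpP`; composed with
  `aaronsonAmbainis2014_thm23_apx_of_dyadicMachines`).

## References

* S. Aaronson, A. Ambainis, *The need for structure in quantum speedups*, Theory Comput. 10
  (2014), arXiv:0911.0996v3, Thm. 23 and its proof (p. 14) [AaronsonAmbainis2014].
-/

noncomputable section

namespace Literature.Barriers.QuantumAdvantage

open MeasureTheory _root_.Computability Literature.Computability.Complexity
  Literature.Computability.Complexity.Classes Literature.Computability.Cryptography
  Literature.Computability.QuantumComplexity Filter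
open scoped ENNReal

/-! ### The bad events and their measurability -/

section Bad

variable (F : QCircuitFamily cliffordT) (C : OracleAlg Bool) (q : Polynomial ℕ)

/-- The bad event on input `x`: the `BQP` promise holds for `F^A` at `x` but `C^A(x)` fails to
output the threshold bit within the budget (the event of claim (apx)). [cite: AaronsonAmbainis2014, proof of Thm. 23 (p. 14)] -/
def badEvent (x : List Bool) : Set (Set (List Bool)) :=
  {A | (2 / 3 ≤ F.acceptProbOn A x ∧ C.run (Oracle.ofLanguage A) (q.eval x.length) x ≠ some true) ∨
       (F.acceptProbOn A x ≤ 1 / 3 ∧ C.run (Oracle.ofLanguage A) (q.eval x.length) x ≠ some false)}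

/-- The bad event is measurable (oracle locality of circuits and of transcript machines). [folklore] -/
theorem measurableSet_badEvent (x : List Bool) : MeasurableSet (badEvent F C q x) := by
  have hrun : ∀ b : Bool, MeasurableSet {A : Set (List Bool) | C.run (Oracle.ofLanguage A) (q.eval x.length) x = some b} := by
    intro b
    have := (isDetermined_runEvent C x (q.eval x.length) ∅ b).measurableSet
    refine (MeasurableSet.congr this (Set.ext fun A => ?_))
    simp only [Set.mem_setOf_eq, OracleAlg.run_ofLanguage_eq_runWith]
  have hp1 : MeasurableSet {A : Set (List Bool) | 2 / 3 ≤ F.acceptProbOn A x} :=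
    (isDetermined_acceptProbOn F x (fun r => 2 / 3 ≤ r)).measurableSet
  have hp2 : MeasurableSet {A : Set (List Bool) | F.acceptProbOn A x ≤ 1 / 3} :=
    (isDetermined_acceptProbOn F x (fun r => r ≤ 1 / 3)).measurableSet
  have e : badEvent F C q x =
      ({A | 2 / 3 ≤ F.acceptProbOn A x} ∩ {A | C.run (Oracle.ofLanguage A) (q.eval x.length) x = some true}ᶜ) ∪
      ({A | F.acceptProbOn A x ≤ 1 / 3} ∩ {A | C.run (Oracle.ofLanguage A) (q.eval x.length) x = some false}ᶜ) := by
    exact Set.ext fun _ => Iff.rfl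
  rw [e]
  exact (hp1.inter (hrun true).compl).union (hp2.inter (hrun false).compl)

/-- The number of bad inputs of length `n` for the oracle `A` (the printed `δ_n(A) · 2ⁿ`). [cite: AaronsonAmbainis2014, proof of Thm. 23 (p. 14, δ_n(A))] -/
def badCount (n : ℕ) (A : Set (List Bool)) : ℕ :=
  open scoped Classical in
  (Finset.univ.filter fun v : List.Vector Bool n => A ∈ badEvent F C q v.toList).card

/-- **Markov's inequality on the sum of the indicators**: `c · μ {A | c ≤ badCount n A} ≤ Σ_x μ (badEvent x)`. [folklore] -/
theorem measure_badCount_ge_le (n : ℕ) (c : ℝ≥0∞) :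
    c * randomOracleMeasure {A | c ≤ (badCount F C q n A : ℝ≥0∞)} ≤
      ∑ v : List.Vector Bool n, randomOracleMeasure (badEvent F C q v.toList) := by
  classical
  set f : Set (List Bool) → ℝ≥0∞ := fun A => ∑ v : List.Vector Bool n, (badEvent F C q v.toList).indicator 1 A with hf
  have hfm : Measurable f := Finset.measurable_sum _ fun v _ =>
    (measurable_one.indicator (measurableSet_badEvent F C q _))
  have hcount : ∀ A, f A = (badCount F C q n A : ℝ≥0∞) := by
    intro A
    simp only [hf, badCount, Set.indicator_apply, Pi.one_apply]
    rw [Finset.sum_boole]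
  have h1 := mul_meas_ge_le_lintegral (μ := randomOracleMeasure) hfm c
  have h2 : ∫⁻ A, f A ∂randomOracleMeasure = ∑ v : List.Vector Bool n, randomOracleMeasure (badEvent F C q v.toList) := by
    rw [hf, lintegral_finsetSum _ fun v _ => measurable_one.indicator (measurableSet_badEvent F C q _)]
    exact Finset.sum_congr rfl fun v _ => lintegral_indicator_one (measurableSet_badEvent F C q _)
  rw [h2] at h1
  simpa only [hcount] using h1

end Bad

/-! ### Summability and Borel–Cantelli -/

section BC

variable (F : QCircuitFamily cliffordT) (C : OracleAlg Bool) (q : Polynomial ℕ)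

/-- The oracles with at least a `1/n` fraction of bad inputs of length `n` (`δ_n(A) ≥ 1/n`). [cite: AaronsonAmbainis2014, proof of Thm. 23 (p. 14)] -/
def manyBad (n : ℕ) : Set (Set (List Bool)) :=
  {A | 2 ^ n ≤ n * badCount F C q n A}

/-- `badCount n` is a measurable function of the oracle (a finite sum of indicators). [folklore] -/
theorem measurable_badCount (n : ℕ) : Measurable fun A => (badCount F C q n A : ℝ≥0∞) := by
  classical
  have : (fun A => (badCount F C q n A : ℝ≥0∞)) =
      fun A => ∑ v : List.Vector Bool n, (badEvent F C q v.toList).indicator 1 A := by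
    funext A
    simp only [badCount, Set.indicator_apply, Pi.one_apply]
    rw [Finset.sum_boole]
  rw [this]
  exact Finset.measurable_sum _ fun v _ => measurable_one.indicator (measurableSet_badEvent F C q _)

/-- **The Markov bound**: under (apx), `μ {A | δ_n(A) ≥ 1/n} ≤ 1/n²` ("by (apx) together with
Markov's inequality"). [cite: AaronsonAmbainis2014, proof of Thm. 23 (p. 14)] -/
theorem measure_manyBad_le
    (hapx : ∀ x : List Bool, 1 ≤ x.length →
      randomOracleMeasure (badEvent F C q x) < ENNReal.ofReal (1 / (x.length : ℝ) ^ 3)) (n : ℕ) :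
    randomOracleMeasure (manyBad F C q n) ≤ ENNReal.ofReal (1 / (n : ℝ) ^ 2) := by
  classical
  rcases Nat.eq_zero_or_pos n with rfl | hn
  · have : manyBad F C q 0 = ∅ := by
      ext A; simp [manyBad]
    rw [this]; simp
  -- Markov with `f = n · badCount`, `ε = 2^n`
  have hfm : Measurable fun A => (n : ℝ≥0∞) * (badCount F C q n A : ℝ≥0∞) :=
    (measurable_badCount F C q n).const_mul _
  have h1 := mul_meas_ge_le_lintegral (μ := randomOracleMeasure) hfm ((2 : ℝ≥0∞) ^ n)
  have hset : {A : Set (List Bool) | (2 : ℝ≥0∞) ^ n ≤ (n : ℝ≥0∞) * (badCount F C q n A : ℝ≥0∞)} = manyBad F C q n := by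
    ext A
    simp only [Set.mem_setOf_eq, manyBad]
    rw [show (2 : ℝ≥0∞) ^ n = ((2 ^ n : ℕ) : ℝ≥0∞) by simp,
      show (n : ℝ≥0∞) * (badCount F C q n A : ℝ≥0∞) = ((n * badCount F C q n A : ℕ) : ℝ≥0∞) by simp]
    exact Nat.cast_le
  rw [hset] at h1
  have h2 : ∫⁻ A, (n : ℝ≥0∞) * (badCount F C q n A : ℝ≥0∞) ∂randomOracleMeasure ≤
      (2 : ℝ≥0∞) ^ n * ((n : ℝ≥0∞) * ENNReal.ofReal (1 / (n : ℝ) ^ 3)) := by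
    rw [lintegral_const_mul _ (measurable_badCount F C q n)]
    have h3 : ∫⁻ A, (badCount F C q n A : ℝ≥0∞) ∂randomOracleMeasure =
        ∑ v : List.Vector Bool n, randomOracleMeasure (badEvent F C q v.toList) := by
      have e : (fun A => (badCount F C q n A : ℝ≥0∞)) =
          fun A => ∑ v : List.Vector Bool n, (badEvent F C q v.toList).indicator 1 A := by
        funext A
        simp only [badCount, Set.indicator_apply, Pi.one_apply]
        rw [Finset.sum_boole]
      rw [e, lintegral_finsetSum _ fun v _ => measurable_one.indicator (measurableSet_badEvent F C q _)]
      exact Finset.sum_congr rfl fun v _ => lintegral_indicator_one (measurableSet_badEvent F C q _)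
    rw [h3]
    have h4 : ∑ v : List.Vector Bool n, randomOracleMeasure (badEvent F C q v.toList) ≤
        ∑ _v : List.Vector Bool n, ENNReal.ofReal (1 / (n : ℝ) ^ 3) :=
      Finset.sum_le_sum fun v _ => by
        have := hapx v.toList (by simp; omega)
        simp only [List.Vector.toList_length] at this
        exact this.le
    refine (mul_le_mul_of_nonneg_left h4 bot_le).trans ?_
    rw [Finset.sum_const, Finset.card_univ, card_vector, Fintype.card_bool, nsmul_eq_mul]
    push_cast
    ring_nf
    exact le_rfl
  have h5 : (2 : ℝ≥0∞) ^ n * randomOracleMeasure (manyBad F C q n) ≤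
      (2 : ℝ≥0∞) ^ n * ((n : ℝ≥0∞) * ENNReal.ofReal (1 / (n : ℝ) ^ 3)) := h1.trans h2
  have h6 : randomOracleMeasure (manyBad F C q n) ≤ (n : ℝ≥0∞) * ENNReal.ofReal (1 / (n : ℝ) ^ 3) :=
    (ENNReal.mul_le_mul_iff_right (pow_ne_zero _ two_ne_zero) (ENNReal.pow_ne_top ENNReal.ofNat_ne_top)).1 h5
  refine h6.trans (le_of_eq ?_)
  rw [← ENNReal.ofReal_natCast, ← ENNReal.ofReal_mul (by positivity)]
  congr 1
  have hn' : (n : ℝ) ≠ 0 := by exact_mod_cast hn.ne'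
  field_simp

/-- The Markov bounds are summable (`Σ 1/n² < ∞`). [cite: AaronsonAmbainis2014, proof of Thm. 23 (p. 14, "since Σ 1/n² converges")] -/
theorem tsum_measure_manyBad_ne_top
    (hapx : ∀ x : List Bool, 1 ≤ x.length →
      randomOracleMeasure (badEvent F C q x) < ENNReal.ofReal (1 / (x.length : ℝ) ^ 3)) :
    ∑' n, randomOracleMeasure (manyBad F C q n) ≠ ∞ := by
  have hsum : Summable fun n : ℕ => 1 / (n : ℝ) ^ 2 := Real.summable_one_div_nat_pow.2 (by norm_num)
  refine ne_top_of_le_ne_top ?_ (ENNReal.tsum_le_tsum (measure_manyBad_le F C q hapx))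
  rw [← ENNReal.ofReal_tsum_of_nonneg (fun n => by positivity) hsum]
  exact ENNReal.ofReal_ne_top

/-- **Borel–Cantelli**: under (apx), almost every oracle has, for all large `n`, fewer than a
`1/n` fraction of bad inputs of length `n` ("`δ_n(A) ≤ 1/n` for all but finitely many values of
`n`, with probability `1` over `A`"). [cite: AaronsonAmbainis2014, proof of Thm. 23 (p. 14)] -/
theorem ae_eventually_few_bad
    (hapx : ∀ x : List Bool, 1 ≤ x.length →
      randomOracleMeasure (badEvent F C q x) < ENNReal.ofReal (1 / (x.length : ℝ) ^ 3)) :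
    ∀ᵐ A ∂randomOracleMeasure, ∀ᶠ n in atTop, n * badCount F C q n A < 2 ^ n := by
  filter_upwards [ae_eventually_notMem (tsum_measure_manyBad_ne_top F C q hapx)] with A hA
  exact hA.mono fun n hn => not_le.1 hn

end BC

/-! ### The error fraction of `C` is at most the bad fraction -/

/-- Under the `BQP^A` promise for `L` via `F`, an input on which `C^A` errs about `L` is bad; so
the error fraction of `C^A` about `L` at length `n` is at most `badCount n A / 2ⁿ`. [folklore] -/
theorem errFraction_le_badCount (F : QCircuitFamily cliffordT) (C : OracleAlg Bool) (q : Polynomial ℕ)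
    {A : Set (List Bool)} {L : Language Bool}
    (hprom : ∀ x, (x ∈ L → 2 / 3 ≤ F.acceptProbOn A x) ∧ (x ∉ L → F.acceptProbOn A x ≤ 1 / 3)) (n : ℕ) :
    errFraction L
        (fun x => C.run (Oracle.ofLanguage A) (q.eval x.length) x) n ≤ badCount F C q n A / 2 ^ n := by
  classical
  unfold errFraction badCount
  refine div_le_div_of_nonneg_right ?_ (by positivity)
  exact_mod_cast Finset.card_le_card fun v hv => by
    simp only [Finset.mem_filter, Finset.mem_univ, true_and, List.Vector.toList_length] at hv ⊢
    simp only [badEvent, Set.mem_setOf_eq, List.Vector.toList_length]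
    by_cases hx : v.toList ∈ L
    · left
      refine ⟨(hprom _).1 hx, fun h => hv ?_⟩
      rw [h, (Set.mem_iff_boolIndicator L _).1 hx]
    · right
      refine ⟨(hprom _).2 hx, fun h => hv ?_⟩
      rw [h, (Set.notMem_iff_boolIndicator L _).1 hx]

/-! ### Theorem 7 (iii) from claim (apx) -/

/-- **The probabilistic half of the proof of Thm. 23, unconditionally**: if every polynomial-time
uniform family `F` of Clifford+T oracle circuits has a polynomial-time transcript machine `C_F`
with a polynomial round/query-length budget `q_F` whose answer is wrong about the `BQP`-promise
bit of `F^A` at an input of length `n ≥ 1` only on a set of oracles of measure `< 1/n³` (the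
content of claim (apx)), then `BQP^A ⊆ AvgP^A` for almost every oracle `A` (Markov,
Borel–Cantelli, countability of the uniform families, squeeze). [cite: AaronsonAmbainis2014, Thm. 23 (proof, p. 14)] -/
theorem ae_BQPRel_subset_AvgPRel_of_apxMachines
    (h : ∀ F : QCircuitFamily cliffordT, F.IsUniform →
      ∃ (C : OracleAlg Bool) (q : Polynomial ℕ), C.IsPolyTime encodingBoolBool ∧
        (∀ (A : Language Bool) (x : List Bool),
          ∀ y ∈ C.queries (Oracle.ofLanguage A) (q.eval x.length) x, y.length ≤ q.eval x.length) ∧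
        ∀ x : List Bool, 1 ≤ x.length →
          randomOracleMeasure (badEvent F C q x) < ENNReal.ofReal (1 / (x.length : ℝ) ^ 3)) :
    ∀ᵐ A ∂randomOracleMeasure,
      BQPRel (A : Language Bool) ⊆ AvgPRel (Oracle.ofLanguage (A : Language Bool)) := by
  have hex : ∀ Fu : {F : QCircuitFamily cliffordT // F.IsUniform},
      ∃ (C : OracleAlg Bool) (q : Polynomial ℕ), C.IsPolyTime encodingBoolBool ∧
        (∀ (A : Language Bool) (x : List Bool),
          ∀ y ∈ C.queries (Oracle.ofLanguage A) (q.eval x.length) x, y.length ≤ q.eval x.length) ∧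
        ∀ x : List Bool, 1 ≤ x.length →
          randomOracleMeasure (badEvent Fu.1 C q x) < ENNReal.ofReal (1 / (x.length : ℝ) ^ 3) :=
    fun Fu => h Fu.1 Fu.2
  choose C q hpoly hquery hapx using hex
  haveI : Countable {F : QCircuitFamily cliffordT // F.IsUniform} := countable_setOf_isUniform.to_subtype
  have hae : ∀ᵐ A ∂randomOracleMeasure, ∀ Fu : {F : QCircuitFamily cliffordT // F.IsUniform},
      ∀ᶠ n in atTop, n * badCount Fu.1 (C Fu) (q Fu) n A < 2 ^ n := by
    rw [ae_all_iff]
    exact fun Fu => ae_eventually_few_bad Fu.1 (C Fu) (q Fu) (hapx Fu)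
  filter_upwards [hae] with A hA
  rintro L ⟨F, hU, hprom⟩
  set Fu : {F : QCircuitFamily cliffordT // F.IsUniform} := ⟨F, hU⟩ with hFu
  refine ⟨C Fu, hpoly Fu, q Fu, fun x => hquery Fu A x, ?_⟩
  -- squeeze the error fraction between `0` and `1/n`
  refine tendsto_of_tendsto_of_tendsto_of_le_of_le' tendsto_const_nhds
    tendsto_one_div_atTop_nhds_zero_nat (Eventually.of_forall fun n =>
      errFraction_nonneg _ _ _) ?_
  filter_upwards [hA Fu, eventually_ge_atTop 1] with n hn hn1
  refine (errFraction_le_badCount F (C Fu) (q Fu) hprom n).trans ?_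
  rw [div_le_div_iff₀ (by positivity) (by exact_mod_cast hn1), one_mul]
  have : ((n * badCount F (C Fu) (q Fu) n A : ℕ) : ℝ) < ((2 ^ n : ℕ) : ℝ) := by exact_mod_cast hn
  push_cast at this
  linarith

/-- **Aaronson–Ambainis 2014, Thm. 7 (iii) (= Thm. 23) from claim (apx)**: if, assuming
Conjecture 6 and `P = P^{#P}`, every uniform quantum oracle machine has a polynomial-time
classical oracle machine erring about its `BQP`-promise bit at length `n ≥ 1` only on a set of
oracles of measure `< 1/n³` — claim (apx) of the printed proof ("there exists a deterministic
polynomial-time algorithm `C` such that for all `Q` and `x ∈ {0,1}ⁿ`,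
`Pr_A[|p̃_x(A) − p_x(A)| > 1/10] < 1/n³`", thresholded at `1/2` as in the proof of Cor. 22; the
hypothesis is literally the conclusion of
`Literature.Computability.QuantumComplexity.aaronsonAmbainis2014_thm23_apx_of_dyadicMachines`)
— then, assuming Conjecture 6 and `P = P^{#P}`, `BQP^A ⊆ AvgP^A` with probability `1` over the
random oracle `A`. [cite: AaronsonAmbainis2014, Thm. 23 (proof, p. 14)] -/
theorem aaronsonAmbainis2014_thm7iii_of_apx
    (h : AAConjecture → P = PSharpP →
      ∀ F : QCircuitFamily cliffordT, F.IsUniform →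
        ∃ (C : OracleAlg Bool) (q : Polynomial ℕ), C.IsPolyTime encodingBoolBool ∧
          (∀ (A : Language Bool) (x : List Bool),
            ∀ y ∈ C.queries (Oracle.ofLanguage A) (q.eval x.length) x, y.length ≤ q.eval x.length) ∧
          ∀ x : List Bool, 1 ≤ x.length →
            randomOracleMeasure {A : Set (List Bool) |
                (2 / 3 ≤ F.acceptProbOn A x ∧
                    C.run (Oracle.ofLanguage A) (q.eval x.length) x ≠ some true) ∨
                (F.acceptProbOn A x ≤ 1 / 3 ∧
                    C.run (Oracle.ofLanguage A) (q.eval x.length) x ≠ some false)}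
              < ENNReal.ofReal (1 / (x.length : ℝ) ^ 3)) :
    aaronsonAmbainis2014_thm7iii :=
  fun hAA hP => ae_BQPRel_subset_AvgPRel_of_apxMachines (h hAA hP)

/-- **The barrier `RandomOracleMethod`, granted claim (apx) alone** (Fortnow–Rogers Thm. 4.4 is
proved, `fortnowRogers1999_thm44_holds`; Aaronson–Ambainis Thm. 7 (iii) follows from (apx)).
[cite: FortnowRogers1999JCSS, Thm. 4.4] [cite: AaronsonAmbainis2014, Thm. 23 (proof, p. 14)] -/
theorem randomOracleMethod_of_apx
    (h : AAConjecture → P = PSharpP →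
      ∀ F : QCircuitFamily cliffordT, F.IsUniform →
        ∃ (C : OracleAlg Bool) (q : Polynomial ℕ), C.IsPolyTime encodingBoolBool ∧
          (∀ (A : Language Bool) (x : List Bool),
            ∀ y ∈ C.queries (Oracle.ofLanguage A) (q.eval x.length) x, y.length ≤ q.eval x.length) ∧
          ∀ x : List Bool, 1 ≤ x.length →
            randomOracleMeasure {A : Set (List Bool) |
                (2 / 3 ≤ F.acceptProbOn A x ∧
                    C.run (Oracle.ofLanguage A) (q.eval x.length) x ≠ some true) ∨
                (F.acceptProbOn A x ≤ 1 / 3 ∧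
                    C.run (Oracle.ofLanguage A) (q.eval x.length) x ≠ some false)}
              < ENNReal.ofReal (1 / (x.length : ℝ) ^ 3)) :
    RandomOracleMethod :=
  ⟨fortnowRogers1999_thm44_holds, aaronsonAmbainis2014_thm7iii_of_apx h⟩

/-! ### The remaining obligation: polynomial-time implementability of the simulation trees -/

/-- **Thm. 7 (iii) from the polynomial-time implementability of the simulation trees** — the
single remaining obligation of the printed proof ("The key point is that we can implement `C`
using not only `poly(n)` queries to `A`, but also `poly(n)` computation steps … under the
assumption `P = P^{#P}`, the entire counting hierarchy collapses to `P`"): if for all `c k : ℕ`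
for which the body of Conjecture 6 holds with constant `2^{-k}`, and under `P = P^{#P}`, every
uniform Clifford+T oracle family `F` has a polynomial-time transcript machine with a polynomial
round/query-length budget computing `A, x ↦ [ (simTreeOn c 2^{-k} F x).eval (oracleBits F x A) ≥ 1/2 ]`
for `|x| ≥ 1`, then `aaronsonAmbainis2014_thm7iii` holds
(`aaronsonAmbainis2014_thm23_apx_of_dyadicMachines`, then `aaronsonAmbainis2014_thm7iii_of_apx`).
Tree tools for the hypothesis: `CH_eq_P_of_P_eq_PSharpP` (the collapse) and `AdQuery.adAlg`
(`AdaptiveQueries.lean`: a transcript machine from a query generator in `FP` and an evaluator in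
`P`). [cite: AaronsonAmbainis2014, Thm. 23 (proof, p. 14)] -/
theorem aaronsonAmbainis2014_thm7iii_of_dyadicMachines
    (hmach : ∀ (c k : ℕ),
      (∀ (N d : ℕ) (p : MvPolynomial (Fin N) ℝ) (ε : ℝ), 1 ≤ d → p.totalDegree ≤ d →
        (∀ y, 0 ≤ evalBool p y ∧ evalBool p y ≤ 1) → 0 < ε → ε ≤ boolVariance p →
          ∃ i : Fin N, (2 : ℝ)⁻¹ ^ k * (ε / d) ^ c ≤ influence i p) →
      P = PSharpP → ∀ F : QCircuitFamily cliffordT, F.IsUniform →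
        ∃ (C : OracleAlg Bool) (q : Polynomial ℕ), C.IsPolyTime encodingBoolBool ∧
          (∀ (A : Language Bool) (x : List Bool),
            ∀ y ∈ C.queries (Oracle.ofLanguage A) (q.eval x.length) x, y.length ≤ q.eval x.length) ∧
          ∀ (A : Language Bool) (x : List Bool), 1 ≤ x.length →
            C.run (Oracle.ofLanguage A) (q.eval x.length) x =
              some (decide (1 / 2 ≤ (simTreeOn c ((2 : ℝ)⁻¹ ^ k) F x).eval (oracleBits F x A)))) :
    aaronsonAmbainis2014_thm7iii :=
  aaronsonAmbainis2014_thm7iii_of_apx (aaronsonAmbainis2014_thm23_apx_of_dyadicMachines hmach)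

/-- **The barrier `RandomOracleMethod` from the same single machine hypothesis.**
[cite: FortnowRogers1999JCSS, Thm. 4.4] [cite: AaronsonAmbainis2014, Thm. 23 (proof, p. 14)] -/
theorem randomOracleMethod_of_dyadicMachines
    (hmach : ∀ (c k : ℕ),
      (∀ (N d : ℕ) (p : MvPolynomial (Fin N) ℝ) (ε : ℝ), 1 ≤ d → p.totalDegree ≤ d →
        (∀ y, 0 ≤ evalBool p y ∧ evalBool p y ≤ 1) → 0 < ε → ε ≤ boolVariance p →
          ∃ i : Fin N, (2 : ℝ)⁻¹ ^ k * (ε / d) ^ c ≤ influence i p) →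
      P = PSharpP → ∀ F : QCircuitFamily cliffordT, F.IsUniform →
        ∃ (C : OracleAlg Bool) (q : Polynomial ℕ), C.IsPolyTime encodingBoolBool ∧
          (∀ (A : Language Bool) (x : List Bool),
            ∀ y ∈ C.queries (Oracle.ofLanguage A) (q.eval x.length) x, y.length ≤ q.eval x.length) ∧
          ∀ (A : Language Bool) (x : List Bool), 1 ≤ x.length →
            C.run (Oracle.ofLanguage A) (q.eval x.length) x =
              some (decide (1 / 2 ≤ (simTreeOn c ((2 : ℝ)⁻¹ ^ k) F x).eval (oracleBits F x A)))) :
    RandomOracleMethod :=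
  ⟨fortnowRogers1999_thm44_holds, aaronsonAmbainis2014_thm7iii_of_dyadicMachines hmach⟩

end Literature.Barriers.QuantumAdvantage

end
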